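import Summits.RiemannHypothesis.RiemannHypothesis.Theorems.WeilTwoPrimeDeflM80XBase
import Literature.NumberTheory.LFunctions.WeilBlockRows
import Literature.NumberTheory.LFunctions.WeilBlockRowsPZ
import Summits.RiemannHypothesis.RiemannHypothesis.Theorems.WeilTwoPrimeDeflM80PDataDnE18
import HarnessLib

/-!
# Calibration certificate M80X: rows 24–29 of the even `D C = I` and rows 46–49 of the claim `D = Dn / Ls` for M80P's factored even inverse

`WeilCert.checkDCRow 0` (6 rows) and `WeilCert.checkDnRow` (4 rows, `weilCertDeflM80XDnE` / `weilCertDeflM80PLsE`) for certificate M80X, by `decide +kernel` (gen3 re-split: ≤ 6 DC rows per file for the gate's 600-s elaboration cap under the farm's load variance). Pure proof file.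
-/

set_option linter.dupNamespace false

noncomputable section

namespace Summit.RiemannHypothesis.RiemannHypothesis.Theorems.EvenWinsBeyondArch

open Literature.NumberTheory.LFunctions

set_option maxHeartbeats 0 in
/-- Kernel check of row 24 of the even `D C = I` (certificate M80X). [folklore] -/
theorem checkDCRow0_24_weilCertDeflM80X : weilCertDeflM80XBase.checkDCRow 0 24 = true := by
  decide +kernel

set_option maxHeartbeats 0 in
/-- Kernel check of row 25 of the even `D C = I` (certificate M80X). [folklore] -/
theorem checkDCRow0_25_weilCertDeflM80X : weilCertDeflM80XBase.checkDCRow 0 25 = true := by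
  decide +kernel

set_option maxHeartbeats 0 in
/-- Kernel check of row 26 of the even `D C = I` (certificate M80X). [folklore] -/
theorem checkDCRow0_26_weilCertDeflM80X : weilCertDeflM80XBase.checkDCRow 0 26 = true := by
  decide +kernel

set_option maxHeartbeats 0 in
/-- Kernel check of row 27 of the even `D C = I` (certificate M80X). [folklore] -/
theorem checkDCRow0_27_weilCertDeflM80X : weilCertDeflM80XBase.checkDCRow 0 27 = true := by
  decide +kernel

set_option maxHeartbeats 0 in
/-- Kernel check of row 28 of the even `D C = I` (certificate M80X). [folklore] -/
theorem checkDCRow0_28_weilCertDeflM80X : weilCertDeflM80XBase.checkDCRow 0 28 = true := by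
  decide +kernel

set_option maxHeartbeats 0 in
/-- Kernel check of row 29 of the even `D C = I` (certificate M80X). [folklore] -/
theorem checkDCRow0_29_weilCertDeflM80X : weilCertDeflM80XBase.checkDCRow 0 29 = true := by
  decide +kernel

-- ===== factored even inverse `D = Dn / Ls`: rows 46–49 =====
set_option maxHeartbeats 0 in
/-- Row 46 of `DnE/LsE` is row 46 of the even `D` (certificate M80X). [folklore] -/
theorem checkDnRow0_46_weilCertDeflM80X : weilCertDeflM80XBase.checkDnRow weilCertDeflM80XDnE weilCertDeflM80PLsE 0 46 = true := by
  decide +kernel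

set_option maxHeartbeats 0 in
/-- Row 47 of `DnE/LsE` is row 47 of the even `D` (certificate M80X). [folklore] -/
theorem checkDnRow0_47_weilCertDeflM80X : weilCertDeflM80XBase.checkDnRow weilCertDeflM80XDnE weilCertDeflM80PLsE 0 47 = true := by
  decide +kernel

set_option maxHeartbeats 0 in
/-- Row 48 of `DnE/LsE` is row 48 of the even `D` (certificate M80X). [folklore] -/
theorem checkDnRow0_48_weilCertDeflM80X : weilCertDeflM80XBase.checkDnRow weilCertDeflM80XDnE weilCertDeflM80PLsE 0 48 = true := by
  decide +kernel

set_option maxHeartbeats 0 in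
/-- Row 49 of `DnE/LsE` is row 49 of the even `D` (certificate M80X). [folklore] -/
theorem checkDnRow0_49_weilCertDeflM80X : weilCertDeflM80XBase.checkDnRow weilCertDeflM80XDnE weilCertDeflM80PLsE 0 49 = true := by
  decide +kernel

end Summit.RiemannHypothesis.RiemannHypothesis.Theorems.EvenWinsBeyondArch

end
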